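import Mathlib
import HarnessLib
import Summits.ResolutionOfSingularities.ResolutionOfSingularities.Theorems.WildQuotientsWildQuotientResolutionS1aA1KillLeaf
import Summits.ResolutionOfSingularities.ResolutionOfSingularities.Theorems.WildQuotientsWildQuotientResolutionS1aD4Move2Ring
import Summits.ResolutionOfSingularities.ResolutionOfSingularities.Theorems.WildQuotientsWildQuotientResolutionS1aUnitShear

/-!
# S1a — INSTANCE I-3 (D₄): the FREE MODEL of the node of the `[z′]` chart (output of `d4_move2`) in SHEARED coordinates `w̃ = Z·s₂ + s·X₁ = x₂`

[OURS · L1 W4.5c · lead-1 g13; plan-1 RULING R-F15e (I-3 move-by-move in the I-2 architecture), NOTES `D4 TREE OF RECORD` (unit shear before move 3); pattern of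
✓`…S1aA1KillLeaf` / ✓`…S1aD4KillLeaf1`] — NOT statements of the manuscript; counted 0; AI-level work, weaker than expert review. Crux
stmt-ResolutionOfSingularities-17941 `CyclicQuotientFourfolds`, line `s1a-logminvertex` v13 (`stub_reachLowerInFX`).
★★ `KillCert.D4.exists_d4ZChartModel` — for the node of `[z′]` over the free model `P = k[s, X₀, X₁, z, x₃][1/h₁]` of `N(x₁)` (rows of ✓`…S1aD4Move2Ring`), an
∃-package: `Φ_Q : ChartRing ≃+* k[w̃, s, Y, X₁, Z, x₃][1/h_Q]` (✓`exists_chartFreeModelEquiv` composed with the UNIT SHEAR ✓`exists_unitShearAwayEquiv` along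
`s₂ ↦ Z·w̃ + s·X₁`, `h_Q = (∏ⱼ (ZX₁ + j(w̃ − sX₁)Ys))^{2d}·Z^{d₂dbar}`), the opaque elements `t = Ξ(s₂)`, `V₀ = c₀⁻¹η^{2d₂}`, `Vi`, `N_X = ∏ σʲ(X₁)`, and every
hypothesis of ✓`d4_move3` / ✓`d4_killsIn_one` about them: the move-3 rows, fixedness, generation, units, degrees, K1′ for the variables `(Y, w̃)`, `char = p`, pins.
-/

set_option linter.dupNamespace false

noncomputable section

open Literature.AlgebraicGeometry.Resolution
open scoped LaurentPolynomial
open MvPolynomial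
open Summit.ResolutionOfSingularities.ResolutionOfSingularities.Theorems.WildQuotientResolution.S1 Summit.ResolutionOfSingularities.ResolutionOfSingularities.Theorems.WildQuotientResolution.S1.CoarseChart
open Summit.ResolutionOfSingularities.ResolutionOfSingularities.Theorems.WildQuotientResolution.S1.ProducerStep Summit.ResolutionOfSingularities.ResolutionOfSingularities.Theorems.WildQuotientResolution.S1.NpFrame Summit.ResolutionOfSingularities.ResolutionOfSingularities.Theorems.WildQuotientResolution.S1.NodeAtlas
open Summit.ResolutionOfSingularities.ResolutionOfSingularities.Theorems.WildQuotientResolution.S1.BlowupCharts Summit.ResolutionOfSingularities.ResolutionOfSingularities.Theorems.WildQuotientResolution.S1.KillCert Summit.ResolutionOfSingularities.ResolutionOfSingularities.Theorems.WildQuotientResolution.S1.ReesBigrading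
open Summit.ResolutionOfSingularities.ResolutionOfSingularities.Theorems.WildQuotientResolution.S1.NodeTransport Summit.ResolutionOfSingularities.ResolutionOfSingularities.Theorems.WildQuotientResolution.S1.CobordantTransport Summit.ResolutionOfSingularities.ResolutionOfSingularities.Theorems.WildQuotientResolution.S1.FreeModel
open Summit.ResolutionOfSingularities.ResolutionOfSingularities.Theorems.WildQuotientResolution.S1.ModelNode

namespace Summit.ResolutionOfSingularities.ResolutionOfSingularities.Theorems.WildQuotientResolution.S1.KillCert.D4

set_option maxHeartbeats 16000000 in
set_option synthInstance.maxHeartbeats 400000 in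
/-- ★★ **The free model of the node of `[z′]` in sheared coordinates, with every fact the next two moves need.** See the module docstring.
[OURS · L1 W4.5c · R-F15e I-3; NOT a statement of the manuscript] -/
theorem exists_d4ZChartModel {p : ℕ} [NeZero p] (hp : p.Prime) {k : Type} [Field k] [CharP k p]
    -- the free model `P = k[s, X₀, X₁, z, x₃][1/h₁]` of the node of `N(x₁)`, re-coordinated
    (hh₁ : MvPolynomial (Option (Fin 4)) k) (d : ℕ) (hd : 0 < d) (hhh₁ : hh₁ = (∏ j : ZMod p, (X (some 1) + C (j.val : k) * (X (some 0) * X none))) ^ (2 * d))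
    (s X₀ X₁ z x₃ : Localization.Away hh₁)
    (hs : s = algebraMap (MvPolynomial (Option (Fin 4)) k) (Localization.Away hh₁) (X none)) (hX₀ : X₀ = algebraMap (MvPolynomial (Option (Fin 4)) k) (Localization.Away hh₁) (X (some 0)))
    (hX₁ : X₁ = algebraMap (MvPolynomial (Option (Fin 4)) k) (Localization.Away hh₁) (X (some 1))) (hz : z = algebraMap (MvPolynomial (Option (Fin 4)) k) (Localization.Away hh₁) (X (some 2)))
    (hx₃ : x₃ = algebraMap (MvPolynomial (Option (Fin 4)) k) (Localization.Away hh₁) (X (some 3)))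
    {m : ℕ} {r : Fin m → ℕ} (𝒜P : (Π j : Fin m, ZMod (r j)) → AddSubgroup (Localization.Away hh₁)) [GradedRing 𝒜P] (θ : Π j : Fin m, ZMod (r j))
    (τP : Localization.Away hh₁ ≃+* Localization.Away hh₁)
    (r0 : τP s = s) (r1 : τP X₀ = X₀) (r2 : τP X₁ = X₁ + X₀ * s) (rz : τP z = z) (r4 : τP x₃ = x₃ - s * X₁ * z * (z + s * X₁))
    (r5 : ∀ g' ∈ (({IsLocalization.Away.invSelf hh₁} : Set (Localization.Away hh₁)) ∪ Set.range (algebraMap k (Localization.Away hh₁))), τP g' = g')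
    (rh : τP (algebraMap (MvPolynomial (Option (Fin 4)) k) (Localization.Away hh₁) hh₁) = algebraMap (MvPolynomial (Option (Fin 4)) k) (Localization.Away hh₁) hh₁)
    (hσp₂ : ∀ x : Localization.Away hh₁, (⇑τP)^[p] x = x)
    (dg1 : X₁ ∈ 𝒜P θ) (dgs : s ∈ 𝒜P (-θ)) (dgη : IsLocalization.Away.invSelf hh₁ ∈ 𝒜P (-((d * (2 * p)) • θ)))
    -- the node of `[z′]` (output of move 2)
    (d₂ : ℕ) (hd₂ : 0 < d₂) (hf₂ : ∀ i, (![z, X₀] : Fin 2 → Localization.Away hh₁) i ∈ 𝒜P ((![0, 2 • θ] : Fin 2 → Π j : Fin m, ZMod (r j)) i))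
    (hσJ₂ : ∀ n : ℕ, ((weightedFiltration (![z, X₀] : Fin 2 → Localization.Away hh₁) ![1, 1]).ideal n).map (τP : Localization.Away hh₁ →+* Localization.Away hh₁) ≤
      (weightedFiltration (![z, X₀] : Fin 2 → Localization.Away hh₁) ![1, 1]).ideal n)
    (y₀ : ↥(𝒜P 0)) (hy₀v : (y₀ : Localization.Away hh₁) = z ^ (d₂ * (d * (2 * p))))
    (hy₀ : y₀ ∈ (traceFiltration 𝒜P (![z, X₀] : Fin 2 → Localization.Away hh₁) ![1, 1]).ideal (d₂ * (d * (2 * p)))) (hσy₀ : τP (y₀ : Localization.Away hh₁) = y₀)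
    -- the target model polynomial
    (hQ : MvPolynomial (Option (Option (Fin 4))) k)
    (hhQ : hQ = (∏ j : ZMod p, (X (some (some 2)) * X (some (some 1)) + C (j.val : k) * ((X none - X (some none) * X (some (some 1))) * X (some (some 0)) * X (some none)))) ^ (2 * d) * X (some (some 2)) ^ (d₂ * (d * (2 * p)))) :
    letI := chartNodeGradedRing r 𝒜P (![z, X₀] : Fin 2 → Localization.Away hh₁) ![1, 1] hf₂ (d₂ * (d * (2 * p))) y₀ hy₀
    ∃ (ΦQ : ChartRing 𝒜P (![z, X₀] : Fin 2 → Localization.Away hh₁) ![1, 1] (d₂ * (d * (2 * p))) y₀ hy₀ ≃+* Localization.Away hQ) (t V₀ Vi NX : Localization.Away hQ),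
      -- rows of `τ_Q = Φ_Q⁻¹ σ_chart Φ_Q`
      conj ΦQ (sigmaChart 𝒜P (![z, X₀] : Fin 2 → Localization.Away hh₁) ![1, 1] (d₂ * (d * (2 * p))) y₀ hy₀ τP hσJ₂ hp.pos hσp₂ hσy₀) t = t ∧
      conj ΦQ (sigmaChart 𝒜P (![z, X₀] : Fin 2 → Localization.Away hh₁) ![1, 1] (d₂ * (d * (2 * p))) y₀ hy₀ τP hσJ₂ hp.pos hσp₂ hσy₀) (algebraMap (MvPolynomial (Option (Option (Fin 4))) k) (Localization.Away hQ) (X (some none))) = algebraMap (MvPolynomial (Option (Option (Fin 4))) k) (Localization.Away hQ) (X (some none)) ∧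
      conj ΦQ (sigmaChart 𝒜P (![z, X₀] : Fin 2 → Localization.Away hh₁) ![1, 1] (d₂ * (d * (2 * p))) y₀ hy₀ τP hσJ₂ hp.pos hσp₂ hσy₀) (algebraMap (MvPolynomial (Option (Option (Fin 4))) k) (Localization.Away hQ) (X (some (some 0)))) = algebraMap (MvPolynomial (Option (Option (Fin 4))) k) (Localization.Away hQ) (X (some (some 0))) ∧
      conj ΦQ (sigmaChart 𝒜P (![z, X₀] : Fin 2 → Localization.Away hh₁) ![1, 1] (d₂ * (d * (2 * p))) y₀ hy₀ τP hσJ₂ hp.pos hσp₂ hσy₀) (algebraMap (MvPolynomial (Option (Option (Fin 4))) k) (Localization.Away hQ) (X (some (some 2)))) = algebraMap (MvPolynomial (Option (Option (Fin 4))) k) (Localization.Away hQ) (X (some (some 2))) ∧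
      conj ΦQ (sigmaChart 𝒜P (![z, X₀] : Fin 2 → Localization.Away hh₁) ![1, 1] (d₂ * (d * (2 * p))) y₀ hy₀ τP hσJ₂ hp.pos hσp₂ hσy₀) (algebraMap (MvPolynomial (Option (Option (Fin 4))) k) (Localization.Away hQ) (X (some (some 1)))) =
        algebraMap (MvPolynomial (Option (Option (Fin 4))) k) (Localization.Away hQ) (X (some (some 1))) + algebraMap (MvPolynomial (Option (Option (Fin 4))) k) (Localization.Away hQ) (X (some none)) * t * algebraMap (MvPolynomial (Option (Option (Fin 4))) k) (Localization.Away hQ) (X (some (some 0))) ∧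
      conj ΦQ (sigmaChart 𝒜P (![z, X₀] : Fin 2 → Localization.Away hh₁) ![1, 1] (d₂ * (d * (2 * p))) y₀ hy₀ τP hσJ₂ hp.pos hσp₂ hσy₀) (algebraMap (MvPolynomial (Option (Option (Fin 4))) k) (Localization.Away hQ) (X (some (some 3)))) =
        algebraMap (MvPolynomial (Option (Option (Fin 4))) k) (Localization.Away hQ) (X (some (some 3))) - algebraMap (MvPolynomial (Option (Option (Fin 4))) k) (Localization.Away hQ) (X (some none)) * t * algebraMap (MvPolynomial (Option (Option (Fin 4))) k) (Localization.Away hQ) (X (some (some 1))) * algebraMap (MvPolynomial (Option (Option (Fin 4))) k) (Localization.Away hQ) (X (some (some 2))) * algebraMap (MvPolynomial (Option (Option (Fin 4))) k) (Localization.Away hQ) (X none) ∧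
      conj ΦQ (sigmaChart 𝒜P (![z, X₀] : Fin 2 → Localization.Away hh₁) ![1, 1] (d₂ * (d * (2 * p))) y₀ hy₀ τP hσJ₂ hp.pos hσp₂ hσy₀) (algebraMap (MvPolynomial (Option (Option (Fin 4))) k) (Localization.Away hQ) (X none)) =
        algebraMap (MvPolynomial (Option (Option (Fin 4))) k) (Localization.Away hQ) (X none) + algebraMap (MvPolynomial (Option (Option (Fin 4))) k) (Localization.Away hQ) (X (some none)) ^ 2 * t * algebraMap (MvPolynomial (Option (Option (Fin 4))) k) (Localization.Away hQ) (X (some (some 0))) ∧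
      conj ΦQ (sigmaChart 𝒜P (![z, X₀] : Fin 2 → Localization.Away hh₁) ![1, 1] (d₂ * (d * (2 * p))) y₀ hy₀ τP hσJ₂ hp.pos hσp₂ hσy₀) V₀ = V₀ ∧ Vi * V₀ = 1 ∧
      conj ΦQ (sigmaChart 𝒜P (![z, X₀] : Fin 2 → Localization.Away hh₁) ![1, 1] (d₂ * (d * (2 * p))) y₀ hy₀ τP hσJ₂ hp.pos hσp₂ hσy₀) NX = NX ∧
      (∀ g' ∈ (({IsLocalization.Away.invSelf hQ} : Set (Localization.Away hQ)) ∪ Set.range (algebraMap k (Localization.Away hQ))),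
        conj ΦQ (sigmaChart 𝒜P (![z, X₀] : Fin 2 → Localization.Away hh₁) ![1, 1] (d₂ * (d * (2 * p))) y₀ hy₀ τP hσJ₂ hp.pos hσp₂ hσy₀) g' = g') ∧
      conj ΦQ (sigmaChart 𝒜P (![z, X₀] : Fin 2 → Localization.Away hh₁) ![1, 1] (d₂ * (d * (2 * p))) y₀ hy₀ τP hσJ₂ hp.pos hσp₂ hσy₀) (algebraMap (MvPolynomial (Option (Option (Fin 4))) k) (Localization.Away hQ) hQ) = algebraMap (MvPolynomial (Option (Option (Fin 4))) k) (Localization.Away hQ) hQ ∧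
      -- generation, units
      Subring.closure (({t, algebraMap (MvPolynomial (Option (Option (Fin 4))) k) (Localization.Away hQ) (X (some none)), algebraMap (MvPolynomial (Option (Option (Fin 4))) k) (Localization.Away hQ) (X (some (some 0))),
          algebraMap (MvPolynomial (Option (Option (Fin 4))) k) (Localization.Away hQ) (X (some (some 1))), algebraMap (MvPolynomial (Option (Option (Fin 4))) k) (Localization.Away hQ) (X (some (some 2))),
          algebraMap (MvPolynomial (Option (Option (Fin 4))) k) (Localization.Away hQ) (X (some (some 3))), algebraMap (MvPolynomial (Option (Option (Fin 4))) k) (Localization.Away hQ) (X none)} : Set (Localization.Away hQ)) ∪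
        (({IsLocalization.Away.invSelf hQ} : Set (Localization.Away hQ)) ∪ Set.range (algebraMap k (Localization.Away hQ)))) = ⊤ ∧
      IsUnit (algebraMap (MvPolynomial (Option (Option (Fin 4))) k) (Localization.Away hQ) (X (some (some 1)))) ∧ IsUnit (algebraMap (MvPolynomial (Option (Option (Fin 4))) k) (Localization.Away hQ) (X (some (some 2)))) ∧
      IsUnit V₀ ∧ IsUnit NX ∧
      -- degrees in the transported grading
      algebraMap (MvPolynomial (Option (Option (Fin 4))) k) (Localization.Away hQ) (X (some (some 0))) ∈ mapGrading (chartNodeGrading r 𝒜P (![z, X₀] : Fin 2 → Localization.Away hh₁) ![1, 1] hf₂ (d₂ * (d * (2 * p))) y₀ hy₀) ΦQ (consIndexEquiv r ((1 : ℤ), 2 • θ)) ∧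
      algebraMap (MvPolynomial (Option (Option (Fin 4))) k) (Localization.Away hQ) (X none) ∈ mapGrading (chartNodeGrading r 𝒜P (![z, X₀] : Fin 2 → Localization.Away hh₁) ![1, 1] hf₂ (d₂ * (d * (2 * p))) y₀ hy₀) ΦQ 0 ∧
      algebraMap (MvPolynomial (Option (Option (Fin 4))) k) (Localization.Away hQ) (X (some none)) ^ 2 * t * algebraMap (MvPolynomial (Option (Option (Fin 4))) k) (Localization.Away hQ) (X (some (some 0))) ∈ mapGrading (chartNodeGrading r 𝒜P (![z, X₀] : Fin 2 → Localization.Away hh₁) ![1, 1] hf₂ (d₂ * (d * (2 * p))) y₀ hy₀) ΦQ 0 ∧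
      algebraMap (MvPolynomial (Option (Option (Fin 4))) k) (Localization.Away hQ) (X (some (some 0))) ^ (2 * d * d₂ * p) * V₀ ∈ mapGrading (chartNodeGrading r 𝒜P (![z, X₀] : Fin 2 → Localization.Away hh₁) ![1, 1] hf₂ (d₂ * (d * (2 * p))) y₀ hy₀) ΦQ 0 ∧
      algebraMap (MvPolynomial (Option (Option (Fin 4))) k) (Localization.Away hQ) (X (some none)) ∈ mapGrading (chartNodeGrading r 𝒜P (![z, X₀] : Fin 2 → Localization.Away hh₁) ![1, 1] hf₂ (d₂ * (d * (2 * p))) y₀ hy₀) ΦQ (consIndexEquiv r ((0 : ℤ), -θ)) ∧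
      t ∈ mapGrading (chartNodeGrading r 𝒜P (![z, X₀] : Fin 2 → Localization.Away hh₁) ![1, 1] hf₂ (d₂ * (d * (2 * p))) y₀ hy₀) ΦQ (consIndexEquiv r ((-1 : ℤ), 0)) ∧
      algebraMap (MvPolynomial (Option (Option (Fin 4))) k) (Localization.Away hQ) (X (some none)) ^ p * NX ∈ mapGrading (chartNodeGrading r 𝒜P (![z, X₀] : Fin 2 → Localization.Away hh₁) ![1, 1] hf₂ (d₂ * (d * (2 * p))) y₀ hy₀) ΦQ 0 ∧
      -- K1′ for `(Y, w̃)`, characteristic, and the two section pins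
      RingTheory.Sequence.IsRegular (Localization.Away hQ) (List.ofFn (![algebraMap (MvPolynomial (Option (Option (Fin 4))) k) (Localization.Away hQ) (X (some (some 0))), algebraMap (MvPolynomial (Option (Option (Fin 4))) k) (Localization.Away hQ) (X none)] : Fin 2 → Localization.Away hQ)) ∧
      IsRegularRing (Localization.Away hQ ⧸ Ideal.span (Set.range (![algebraMap (MvPolynomial (Option (Option (Fin 4))) k) (Localization.Away hQ) (X (some (some 0))), algebraMap (MvPolynomial (Option (Option (Fin 4))) k) (Localization.Away hQ) (X none)] : Fin 2 → Localization.Away hQ))) ∧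
      CharP (Localization.Away hQ) p ∧
      ΦQ (algebraMap ↥(cobordantAlgebra (![z, X₀] : Fin 2 → Localization.Away hh₁) ![1, 1]) _ (cobordantAlgebra.u' (![z, X₀] : Fin 2 → Localization.Away hh₁) ![1, 1] 1)) = algebraMap (MvPolynomial (Option (Option (Fin 4))) k) (Localization.Away hQ) (X (some (some 0))) ∧
      ΦQ (algebraMap ↥(cobordantAlgebra (![z, X₀] : Fin 2 → Localization.Away hh₁) ![1, 1]) _ (algebraMap (Localization.Away hh₁) _ X₀)) = t * algebraMap (MvPolynomial (Option (Option (Fin 4))) k) (Localization.Away hQ) (X (some (some 0))) := by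
  classical
  letI instN := chartNodeGradedRing r 𝒜P (![z, X₀] : Fin 2 → Localization.Away hh₁) ![1, 1] hf₂ (d₂ * (d * (2 * p))) y₀ hy₀
  have hp1 : p ≠ 1 := hp.one_lt.ne'
  have hdp : 0 < d * p := Nat.mul_pos hd hp.pos
  have hK : 0 < d₂ * (d * (2 * p)) := Nat.mul_pos hd₂ (Nat.mul_pos hd (Nat.mul_pos two_pos hp.pos))
  -- ### the free model `k[s₂, s, Y, X₁, Z, x₃][1/h₂]` of the chart ring
  have hv : Function.Injective (![some 2, some 0] : Fin 2 → Option (Fin 4)) := by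
    intro i j hij; fin_cases i <;> fin_cases j <;> first | rfl | exact absurd hij (by decide)
  have hvW : ∀ i, (fun o : Option (Fin 4) => Option.elim o 0 ![1, 0, 1, 0]) ((![some 2, some 0] : Fin 2 → Option (Fin 4)) i) = (![1, 1] : Fin 2 → ℕ) i := by
    intro i; fin_cases i <;> rfl
  have hW : ∀ l : Option (Fin 4), (fun o : Option (Fin 4) => Option.elim o 0 ![1, 0, 1, 0]) l = 0 ∨ ∃ i, (![some 2, some 0] : Fin 2 → Option (Fin 4)) i = l := by
    rintro (_ | l)
    · exact Or.inl rfl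
    · fin_cases l
      · exact Or.inr ⟨1, rfl⟩
      · exact Or.inl rfl
      · exact Or.inr ⟨0, rfl⟩
      · exact Or.inl rfl
  have hf₂' : ∀ i, (![z, X₀] : Fin 2 → Localization.Away hh₁) i = algebraMap (MvPolynomial (Option (Fin 4)) k) (Localization.Away hh₁) (X ((![some 2, some 0] : Fin 2 → Option (Fin 4)) i)) := by
    intro i; fin_cases i
    · exact hz
    · exact hX₀
  have hc0R : coverElement 𝒜P (![z, X₀] : Fin 2 → Localization.Away hh₁) ![1, 1] (d₂ * (d * (2 * p))) y₀ hy₀ = cobordantAlgebra.u' _ ![1, 1] 0 ^ (d₂ * (d * (2 * p))) := by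
    refine Subtype.ext ?_
    rw [coe_coverElement, hy₀v, SubmonoidClass.coe_pow, cobordantAlgebra.coe_u']
    change _ = (LaurentPolynomial.C z * LaurentPolynomial.T ((1 : ℕ) : ℤ)) ^ (d₂ * (d * (2 * p)))
    rw [mul_pow, ← map_pow, LaurentPolynomial.T_pow, show ((d₂ * (d * (2 * p)) : ℕ) : ℤ) * ((1 : ℕ) : ℤ) = ((d₂ * (d * (2 * p)) : ℕ) : ℤ) by push_cast; ring]
  have hzass : ∀ Ψ : ↥(cobordantAlgebra (![z, X₀] : Fin 2 → Localization.Away hh₁) ![1, 1]) ≃+* Localization.Away (cobordantAlgebra.subst k (fun o : Option (Fin 4) => Option.elim o 0 ![1, 0, 1, 0]) hh₁),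
      (∀ a : MvPolynomial (Option (Fin 4)) k, Ψ (algebraMap (Localization.Away hh₁) _ (algebraMap (MvPolynomial (Option (Fin 4)) k) (Localization.Away hh₁) a)) =
          algebraMap (MvPolynomial (Option (Option (Fin 4))) k) _ (cobordantAlgebra.subst k (fun o : Option (Fin 4) => Option.elim o 0 ![1, 0, 1, 0]) a)) →
      Ψ (cobordantAlgebra.s _ ![1, 1]) = algebraMap (MvPolynomial (Option (Option (Fin 4))) k) _ (X none) →
      (∀ i, Ψ (cobordantAlgebra.u' _ ![1, 1] i) = algebraMap (MvPolynomial (Option (Option (Fin 4))) k) _ (X (some ((![some 2, some 0] : Fin 2 → Option (Fin 4)) i)))) →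
      Associated (algebraMap (MvPolynomial (Option (Option (Fin 4))) k) (Localization.Away (cobordantAlgebra.subst k (fun o : Option (Fin 4) => Option.elim o 0 ![1, 0, 1, 0]) hh₁)) (X (some (some 2)) ^ (d₂ * (d * (2 * p)))))
        (Ψ (coverElement 𝒜P (![z, X₀] : Fin 2 → Localization.Away hh₁) ![1, 1] (d₂ * (d * (2 * p))) y₀ hy₀)) := by
    intro Ψ _ _ hu
    refine ⟨1, ?_⟩
    rw [Units.val_one, mul_one, hc0R]
    simp only [map_pow, hu 0, Matrix.cons_val_zero]
  obtain ⟨Φ₂, hΦa, hΦS, hΦu⟩ := exists_chartFreeModelEquiv k (fun o : Option (Fin 4) => Option.elim o 0 ![1, 0, 1, 0]) hh₁ (![some 2, some 0]) ![1, 1] hvW hW _ hf₂' 𝒜P (d₂ * (d * (2 * p))) y₀ hy₀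
    (X (some (some 2)) ^ (d₂ * (d * (2 * p)))) hzass
  -- the explicit `h₂ = subst h₁ · Z^{K₂}`
  have hsub : ∀ o : Option (Fin 4), cobordantAlgebra.subst k (fun o : Option (Fin 4) => Option.elim o 0 ![1, 0, 1, 0]) (X o) = X none ^ ((fun o : Option (Fin 4) => Option.elim o 0 ![1, 0, 1, 0]) o) * X (some o) := fun o => by
    rw [cobordantAlgebra.subst, MvPolynomial.eval₂Hom_X']
  have hsubh : cobordantAlgebra.subst k (fun o : Option (Fin 4) => Option.elim o 0 ![1, 0, 1, 0]) hh₁ = (∏ j : ZMod p, (X (some (some 1)) + C (j.val : k) * (X none * X (some (some 0)) * X (some none)))) ^ (2 * d) := by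
    rw [hhh₁, map_pow, map_prod]
    refine congrArg (· ^ (2 * d)) (Finset.prod_congr rfl fun j _ => ?_)
    rw [map_add, map_mul, map_mul, hsub, hsub, hsub, cobordantAlgebra.subst, MvPolynomial.eval₂Hom_C]
    change X none ^ 0 * _ + _ * (X none ^ 1 * _ * (X none ^ 0 * _)) = _
    simp only [pow_zero, one_mul, pow_one]
  -- ### the unit shear `s₂ ↦ Z·w̃ + s·X₁`
  have hφh : MvPolynomial.aeval (fun l : Option (Option (Fin 4)) => if l = none then (X (some (some 2)) * X none + X (some none) * X (some (some 1)) : MvPolynomial (Option (Option (Fin 4))) k) else X l) hQ =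
      X (some (some 2)) ^ (p * (2 * d)) * (cobordantAlgebra.subst k (fun o : Option (Fin 4) => Option.elim o 0 ![1, 0, 1, 0]) hh₁ * X (some (some 2)) ^ (d₂ * (d * (2 * p)))) := by
    have hX : ∀ l : Option (Option (Fin 4)), l ≠ none → MvPolynomial.aeval (fun l : Option (Option (Fin 4)) => if l = none then (X (some (some 2)) * X none + X (some none) * X (some (some 1)) : MvPolynomial (Option (Option (Fin 4))) k) else X l) (X l : MvPolynomial (Option (Option (Fin 4))) k) = X l :=
      fun l hl => by rw [MvPolynomial.aeval_X, if_neg hl]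
    have hn : MvPolynomial.aeval (fun l : Option (Option (Fin 4)) => if l = none then (X (some (some 2)) * X none + X (some none) * X (some (some 1)) : MvPolynomial (Option (Option (Fin 4))) k) else X l) (X none : MvPolynomial (Option (Option (Fin 4))) k) = X (some (some 2)) * X none + X (some none) * X (some (some 1)) := by
      rw [MvPolynomial.aeval_X, if_pos rfl]
    have hfac : ∀ j : ZMod p, MvPolynomial.aeval (fun l : Option (Option (Fin 4)) => if l = none then (X (some (some 2)) * X none + X (some none) * X (some (some 1)) : MvPolynomial (Option (Option (Fin 4))) k) else X l)
        (X (some (some 2)) * X (some (some 1)) + C (j.val : k) * ((X none - X (some none) * X (some (some 1))) * X (some (some 0)) * X (some none)) : MvPolynomial (Option (Option (Fin 4))) k) =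
        X (some (some 2)) * (X (some (some 1)) + C (j.val : k) * (X none * X (some (some 0)) * X (some none))) := by
      intro j
      simp only [map_add, map_mul, map_sub, MvPolynomial.aeval_C, MvPolynomial.algebraMap_eq, hn, hX _ (Option.some_ne_none _)]
      ring
    rw [hhQ, hsubh, map_mul, map_pow, map_pow, map_prod, hX _ (Option.some_ne_none _), Finset.prod_congr rfl (fun j _ => hfac j), Finset.prod_mul_distrib, Finset.prod_const, Finset.card_univ, ZMod.card,
      mul_pow, ← pow_mul]
    ring
  have hvu : (none : Option (Option (Fin 4))) ∉ (X (some (some 2)) : MvPolynomial (Option (Option (Fin 4))) k).vars := by rw [MvPolynomial.vars_X]; simp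
  have hvq : (none : Option (Option (Fin 4))) ∉ (X (some none) * X (some (some 1)) : MvPolynomial (Option (Option (Fin 4))) k).vars := by
    intro h; have h' := MvPolynomial.vars_mul _ _ h; rw [MvPolynomial.vars_X, MvPolynomial.vars_X] at h'; simp at h'
  have huh : (X (some (some 2)) : MvPolynomial (Option (Option (Fin 4))) k) ∣ cobordantAlgebra.subst k (fun o : Option (Fin 4) => Option.elim o 0 ![1, 0, 1, 0]) hh₁ * X (some (some 2)) ^ (d₂ * (d * (2 * p))) :=
    Dvd.dvd.mul_left (dvd_pow_self _ hK.ne') _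
  have huh' : (X (some (some 2)) : MvPolynomial (Option (Option (Fin 4))) k) ∣ hQ := by rw [hhQ]; exact Dvd.dvd.mul_left (dvd_pow_self _ hK.ne') _
  obtain ⟨Ξ, hΞ1, hΞ2, hΞ3, hΞ4⟩ := exists_unitShearAwayEquiv k (none : Option (Option (Fin 4))) (X (some (some 2))) (X (some none) * X (some (some 1))) _ hQ (p * (2 * d)) hvu hvq huh huh' hφh
  -- ### the composite model `Φ_Q = Φ₂ ≫ Ξ` and its dictionary
  set ΦQ := Φ₂.trans Ξ with hΦQdef
  have hΦQ : ∀ x, ΦQ x = Ξ (Φ₂ x) := fun x => rfl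
  letI instM := mapGradedRing (chartNodeGrading r 𝒜P (![z, X₀] : Fin 2 → Localization.Away hh₁) ![1, 1] hf₂ (d₂ * (d * (2 * p))) y₀ hy₀) ΦQ
  set t := Ξ (algebraMap (MvPolynomial (Option (Option (Fin 4))) k) (Localization.Away (cobordantAlgebra.subst k (fun o : Option (Fin 4) => Option.elim o 0 ![1, 0, 1, 0]) hh₁ * X (some (some 2)) ^ (d₂ * (d * (2 * p))))) (X none)) with htdef
  have hΞX : ∀ l : Option (Option (Fin 4)), l ≠ none → Ξ (algebraMap (MvPolynomial (Option (Option (Fin 4))) k) (Localization.Away (cobordantAlgebra.subst k (fun o : Option (Fin 4) => Option.elim o 0 ![1, 0, 1, 0]) hh₁ * X (some (some 2)) ^ (d₂ * (d * (2 * p))))) (X l)) = algebraMap (MvPolynomial (Option (Option (Fin 4))) k) (Localization.Away hQ) (X l) := fun l hl => hΞ2 _ (by rw [MvPolynomial.vars_X]; simpa using hl.symm)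
  have hΞC : ∀ c : k, Ξ (algebraMap (MvPolynomial (Option (Option (Fin 4))) k) (Localization.Away (cobordantAlgebra.subst k (fun o : Option (Fin 4) => Option.elim o 0 ![1, 0, 1, 0]) hh₁ * X (some (some 2)) ^ (d₂ * (d * (2 * p))))) (C c)) = algebraMap (MvPolynomial (Option (Option (Fin 4))) k) (Localization.Away hQ) (C c) := fun c => hΞ2 _ (by simp [MvPolynomial.vars_C])
  have hsub0 : ∀ o : Option (Fin 4), Φ₂ (algebraMap ↥(cobordantAlgebra (![z, X₀] : Fin 2 → Localization.Away hh₁) ![1, 1]) (ChartRing 𝒜P (![z, X₀] : Fin 2 → Localization.Away hh₁) ![1, 1] (d₂ * (d * (2 * p))) y₀ hy₀) (algebraMap (Localization.Away hh₁) ↥(cobordantAlgebra (![z, X₀] : Fin 2 → Localization.Away hh₁) ![1, 1]) (algebraMap (MvPolynomial (Option (Fin 4)) k) (Localization.Away hh₁) (X o)))) = algebraMap (MvPolynomial (Option (Option (Fin 4))) k) (Localization.Away (cobordantAlgebra.subst k (fun o : Option (Fin 4) => Option.elim o 0 ![1, 0, 1, 0]) hh₁ * X (some (some 2)) ^ (d₂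 * (d * (2 * p))))) (X none) ^ ((fun o : Option (Fin 4) => Option.elim o 0 ![1, 0, 1, 0]) o) * algebraMap (MvPolynomial (Option (Option (Fin 4))) k) (Localization.Away (cobordantAlgebra.subst k (fun o : Option (Fin 4) => Option.elim o 0 ![1, 0, 1, 0]) hh₁ * X (some (some 2)) ^ (d₂ * (d * (2 * p))))) (X (some o)) := fun o => by
    rw [hΦa, hsub, map_mul, map_pow]
  have hQs : ΦQ (algebraMap ↥(cobordantAlgebra (![z, X₀] : Fin 2 → Localization.Away hh₁) ![1, 1]) (ChartRing 𝒜P (![z, X₀] : Fin 2 → Localization.Away hh₁) ![1, 1] (d₂ * (d * (2 * p))) y₀ hy₀) (algebraMap (Localization.Away hh₁) ↥(cobordantAlgebra (![z, X₀] : Fin 2 → Localization.Away hh₁) ![1, 1]) s)) = algebraMap (MvPolynomial (Option (Option (Fin 4))) k) (Localization.Away hQ) (X (some none)) := by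
    rw [hΦQ, hs, hsub0]; change Ξ (_ ^ 0 * _) = _; rw [pow_zero, one_mul, hΞX _ (Option.some_ne_none _)]
  have hQX₁ : ΦQ (algebraMap ↥(cobordantAlgebra (![z, X₀] : Fin 2 → Localization.Away hh₁) ![1, 1]) (ChartRing 𝒜P (![z, X₀] : Fin 2 → Localization.Away hh₁) ![1, 1] (d₂ * (d * (2 * p))) y₀ hy₀) (algebraMap (Localization.Away hh₁) ↥(cobordantAlgebra (![z, X₀] : Fin 2 → Localization.Away hh₁) ![1, 1]) X₁)) = algebraMap (MvPolynomial (Option (Option (Fin 4))) k) (Localization.Away hQ) (X (some (some 1))) := by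
    rw [hΦQ, hX₁, hsub0]; change Ξ (_ ^ 0 * _) = _; rw [pow_zero, one_mul, hΞX _ (Option.some_ne_none _)]
  have hQx₃ : ΦQ (algebraMap ↥(cobordantAlgebra (![z, X₀] : Fin 2 → Localization.Away hh₁) ![1, 1]) (ChartRing 𝒜P (![z, X₀] : Fin 2 → Localization.Away hh₁) ![1, 1] (d₂ * (d * (2 * p))) y₀ hy₀) (algebraMap (Localization.Away hh₁) ↥(cobordantAlgebra (![z, X₀] : Fin 2 → Localization.Away hh₁) ![1, 1]) x₃)) = algebraMap (MvPolynomial (Option (Option (Fin 4))) k) (Localization.Away hQ) (X (some (some 3))) := by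
    rw [hΦQ, hx₃, hsub0]; change Ξ (_ ^ 0 * _) = _; rw [pow_zero, one_mul, hΞX _ (Option.some_ne_none _)]
  have hQX₀ : ΦQ (algebraMap ↥(cobordantAlgebra (![z, X₀] : Fin 2 → Localization.Away hh₁) ![1, 1]) (ChartRing 𝒜P (![z, X₀] : Fin 2 → Localization.Away hh₁) ![1, 1] (d₂ * (d * (2 * p))) y₀ hy₀) (algebraMap (Localization.Away hh₁) ↥(cobordantAlgebra (![z, X₀] : Fin 2 → Localization.Away hh₁) ![1, 1]) X₀)) = t * algebraMap (MvPolynomial (Option (Option (Fin 4))) k) (Localization.Away hQ) (X (some (some 0))) := by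
    have h0 := hsub0 (some 0); rw [← hX₀] at h0
    rw [hΦQ, h0]; change Ξ (_ ^ 1 * _) = _; rw [pow_one, map_mul, ← htdef, hΞX _ (Option.some_ne_none _)]
  have hQz : ΦQ (algebraMap ↥(cobordantAlgebra (![z, X₀] : Fin 2 → Localization.Away hh₁) ![1, 1]) (ChartRing 𝒜P (![z, X₀] : Fin 2 → Localization.Away hh₁) ![1, 1] (d₂ * (d * (2 * p))) y₀ hy₀) (algebraMap (Localization.Away hh₁) ↥(cobordantAlgebra (![z, X₀] : Fin 2 → Localization.Away hh₁) ![1, 1]) z)) = t * algebraMap (MvPolynomial (Option (Option (Fin 4))) k) (Localization.Away hQ) (X (some (some 2))) := by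
    have h0 := hsub0 (some 2); rw [← hz] at h0
    rw [hΦQ, h0]; change Ξ (_ ^ 1 * _) = _; rw [pow_one, map_mul, ← htdef, hΞX _ (Option.some_ne_none _)]
  have hQS : ΦQ (algebraMap ↥(cobordantAlgebra (![z, X₀] : Fin 2 → Localization.Away hh₁) ![1, 1]) (ChartRing 𝒜P (![z, X₀] : Fin 2 → Localization.Away hh₁) ![1, 1] (d₂ * (d * (2 * p))) y₀ hy₀) (cobordantAlgebra.s (![z, X₀] : Fin 2 → Localization.Away hh₁) ![1, 1])) = t := by rw [hΦQ, hΦS]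
  have hQu0 : ΦQ (algebraMap ↥(cobordantAlgebra (![z, X₀] : Fin 2 → Localization.Away hh₁) ![1, 1]) (ChartRing 𝒜P (![z, X₀] : Fin 2 → Localization.Away hh₁) ![1, 1] (d₂ * (d * (2 * p))) y₀ hy₀) (cobordantAlgebra.u' (![z, X₀] : Fin 2 → Localization.Away hh₁) ![1, 1] 0)) = algebraMap (MvPolynomial (Option (Option (Fin 4))) k) (Localization.Away hQ) (X (some (some 2))) := by
    rw [hΦQ, hΦu 0]; exact hΞX _ (Option.some_ne_none _)
  have hQu1 : ΦQ (algebraMap ↥(cobordantAlgebra (![z, X₀] : Fin 2 → Localization.Away hh₁) ![1, 1]) (ChartRing 𝒜P (![z, X₀] : Fin 2 → Localization.Away hh₁) ![1, 1] (d₂ * (d * (2 * p))) y₀ hy₀) (cobordantAlgebra.u' (![z, X₀] : Fin 2 → Localization.Away hh₁) ![1, 1] 1)) = algebraMap (MvPolynomial (Option (Option (Fin 4))) k) (Localization.Away hQ) (X (some (some 0))) := by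
    rw [hΦQ, hΦu 1]; exact hΞX _ (Option.some_ne_none _)
  have hQC : ∀ c : k, ΦQ (algebraMap ↥(cobordantAlgebra (![z, X₀] : Fin 2 → Localization.Away hh₁) ![1, 1]) (ChartRing 𝒜P (![z, X₀] : Fin 2 → Localization.Away hh₁) ![1, 1] (d₂ * (d * (2 * p))) y₀ hy₀) (algebraMap (Localization.Away hh₁) ↥(cobordantAlgebra (![z, X₀] : Fin 2 → Localization.Away hh₁) ![1, 1]) (algebraMap (MvPolynomial (Option (Fin 4)) k) (Localization.Away hh₁) (C c)))) = algebraMap (MvPolynomial (Option (Option (Fin 4))) k) (Localization.Away hQ) (C c) := fun c => by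
    have hsubC : cobordantAlgebra.subst k (fun o : Option (Fin 4) => Option.elim o 0 ![1, 0, 1, 0]) (C c) = C c := by rw [cobordantAlgebra.subst, MvPolynomial.eval₂Hom_C]
    rw [hΦQ, hΦa, hsubC, hΞC]
  have hww : algebraMap (MvPolynomial (Option (Option (Fin 4))) k) (Localization.Away hQ) (X (some (some 2))) * t + algebraMap (MvPolynomial (Option (Option (Fin 4))) k) (Localization.Away hQ) (X (some none)) * algebraMap (MvPolynomial (Option (Option (Fin 4))) k) (Localization.Away hQ) (X (some (some 1))) = algebraMap (MvPolynomial (Option (Option (Fin 4))) k) (Localization.Away hQ) (X none) := by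
    have h := hΞ3; rwa [map_mul] at h
  -- the inverted element and the old inverted elements
  set η' := ΦQ (algebraMap ↥(cobordantAlgebra (![z, X₀] : Fin 2 → Localization.Away hh₁) ![1, 1]) (ChartRing 𝒜P (![z, X₀] : Fin 2 → Localization.Away hh₁) ![1, 1] (d₂ * (d * (2 * p))) y₀ hy₀) (algebraMap (Localization.Away hh₁) ↥(cobordantAlgebra (![z, X₀] : Fin 2 → Localization.Away hh₁) ![1, 1]) (IsLocalization.Away.invSelf hh₁))) with hη'def
  set ηh := ΦQ (algebraMap ↥(cobordantAlgebra (![z, X₀] : Fin 2 → Localization.Away hh₁) ![1, 1]) (ChartRing 𝒜P (![z, X₀] : Fin 2 → Localization.Away hh₁) ![1, 1] (d₂ * (d * (2 * p))) y₀ hy₀) (algebraMap (Localization.Away hh₁) ↥(cobordantAlgebra (![z, X₀] : Fin 2 → Localization.Away hh₁) ![1, 1]) (algebraMap (MvPolynomial (Option (Fin 4)) k) (Localization.Away hh₁) hh₁))) with hηhdef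
  set c₀' := ΦQ (algebraMap ↥(cobordantAlgebra (![z, X₀] : Fin 2 → Localization.Away hh₁) ![1, 1]) (ChartRing 𝒜P (![z, X₀] : Fin 2 → Localization.Away hh₁) ![1, 1] (d₂ * (d * (2 * p))) y₀ hy₀) (coverElement 𝒜P (![z, X₀] : Fin 2 → Localization.Away hh₁) ![1, 1] (d₂ * (d * (2 * p))) y₀ hy₀)) with hc₀'def
  set κ' := ΦQ (IsLocalization.Away.invSelf (coverElement 𝒜P (![z, X₀] : Fin 2 → Localization.Away hh₁) ![1, 1] (d₂ * (d * (2 * p))) y₀ hy₀)) with hκ'def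
  have hcκ : c₀' * κ' = 1 := by rw [hc₀'def, hκ'def, ← map_mul, IsLocalization.Away.mul_invSelf, map_one]
  have hηη : ηh * η' = 1 := by rw [hηhdef, hη'def, ← map_mul, ← map_mul, ← map_mul, IsLocalization.Away.mul_invSelf, map_one, map_one, map_one]
  have hQh : algebraMap (MvPolynomial (Option (Option (Fin 4))) k) (Localization.Away hQ) hQ = algebraMap (MvPolynomial (Option (Option (Fin 4))) k) (Localization.Away hQ) (X (some (some 2))) ^ (p * (2 * d)) * (ηh * algebraMap (MvPolynomial (Option (Option (Fin 4))) k) (Localization.Away hQ) (X (some (some 2))) ^ (d₂ * (d * (2 * p)))) := by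
    have h1 := hΞ1 hQ
    rw [hφh, RingEquiv.symm_apply_eq] at h1
    rw [h1]
    simp only [map_mul, map_pow]
    rw [hΞX _ (Option.some_ne_none _), ← hΦa hh₁, ← hΦQ]
  -- ### rows of `τ_Q`
  have hτ : ∀ b, conj ΦQ (sigmaChart 𝒜P (![z, X₀] : Fin 2 → Localization.Away hh₁) ![1, 1] (d₂ * (d * (2 * p))) y₀ hy₀ τP hσJ₂ hp.pos hσp₂ hσy₀) (ΦQ b) = ΦQ ((sigmaChart 𝒜P (![z, X₀] : Fin 2 → Localization.Away hh₁) ![1, 1] (d₂ * (d * (2 * p))) y₀ hy₀ τP hσJ₂ hp.pos hσp₂ hσy₀) b) := fun b => conj_apply_map ΦQ _ b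
  have hσfixP : ∀ x : Localization.Away hh₁, τP x = x → conj ΦQ (sigmaChart 𝒜P (![z, X₀] : Fin 2 → Localization.Away hh₁) ![1, 1] (d₂ * (d * (2 * p))) y₀ hy₀ τP hσJ₂ hp.pos hσp₂ hσy₀) (ΦQ (algebraMap ↥(cobordantAlgebra (![z, X₀] : Fin 2 → Localization.Away hh₁) ![1, 1]) (ChartRing 𝒜P (![z, X₀] : Fin 2 → Localization.Away hh₁) ![1, 1] (d₂ * (d * (2 * p))) y₀ hy₀) (algebraMap (Localization.Away hh₁) ↥(cobordantAlgebra (![z, X₀] : Fin 2 → Localization.Away hh₁) ![1, 1]) x))) = ΦQ (algebraMap ↥(cobordantAlgebra (![z, X₀] : Fin 2 → Localization.Away hh₁) ![1, 1]) (ChartRing 𝒜P (![z, X₀] : Fin 2 → Localization.Away hh₁) ![1, 1] (d₂ * (d * (2 * p))) y₀ hy₀) (algebraMap (Localization.Away hh₁) ↥(cobordantAlgebra (![z, X₀] : Fin 2 → Localization.Away hh₁) ![1, 1]) x)) := by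
    intro x hx; rw [hτ]; rw [sigmaChart_algebraMap, sigmaR_algebraMap, hx]
  have hσt : conj ΦQ (sigmaChart 𝒜P (![z, X₀] : Fin 2 → Localization.Away hh₁) ![1, 1] (d₂ * (d * (2 * p))) y₀ hy₀ τP hσJ₂ hp.pos hσp₂ hσy₀) t = t := by rw [← hQS, hτ]; rw [sigmaChart_algebraMap, sigmaR_s]
  have hσs : conj ΦQ (sigmaChart 𝒜P (![z, X₀] : Fin 2 → Localization.Away hh₁) ![1, 1] (d₂ * (d * (2 * p))) y₀ hy₀ τP hσJ₂ hp.pos hσp₂ hσy₀) (algebraMap (MvPolynomial (Option (Option (Fin 4))) k) (Localization.Away hQ) (X (some none))) = algebraMap (MvPolynomial (Option (Option (Fin 4))) k) (Localization.Away hQ) (X (some none)) := by rw [← hQs]; exact hσfixP s r0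
  have hσX₁ : conj ΦQ (sigmaChart 𝒜P (![z, X₀] : Fin 2 → Localization.Away hh₁) ![1, 1] (d₂ * (d * (2 * p))) y₀ hy₀ τP hσJ₂ hp.pos hσp₂ hσy₀) (algebraMap (MvPolynomial (Option (Option (Fin 4))) k) (Localization.Away hQ) (X (some (some 1)))) = algebraMap (MvPolynomial (Option (Option (Fin 4))) k) (Localization.Away hQ) (X (some (some 1))) + algebraMap (MvPolynomial (Option (Option (Fin 4))) k) (Localization.Away hQ) (X (some none)) * t * algebraMap (MvPolynomial (Option (Option (Fin 4))) k) (Localization.Away hQ) (X (some (some 0))) := by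
    rw [← hQX₁, hτ]; rw [sigmaChart_algebraMap, sigmaR_algebraMap, r2]
    simp only [map_add, map_mul]
    rw [hQX₁, hQX₀, hQs]; ring
  have hσx₃ : conj ΦQ (sigmaChart 𝒜P (![z, X₀] : Fin 2 → Localization.Away hh₁) ![1, 1] (d₂ * (d * (2 * p))) y₀ hy₀ τP hσJ₂ hp.pos hσp₂ hσy₀) (algebraMap (MvPolynomial (Option (Option (Fin 4))) k) (Localization.Away hQ) (X (some (some 3)))) = algebraMap (MvPolynomial (Option (Option (Fin 4))) k) (Localization.Away hQ) (X (some (some 3))) - algebraMap (MvPolynomial (Option (Option (Fin 4))) k) (Localization.Away hQ) (X (some none)) * t * algebraMap (MvPolynomial (Option (Option (Fin 4))) k) (Localization.Away hQ) (X (some (some 1))) * algebraMap (MvPolynomial (Option (Option (Fin 4))) k) (Localization.Away hQ) (X (some (some 2))) * algebraMap (MvPolynomial (Option (Option (Fin 4))) k) (Localization.Away hQ) (X none) := by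
    rw [← hQx₃, hτ]; rw [sigmaChart_algebraMap, sigmaR_algebraMap, r4]
    simp only [map_sub, map_add, map_mul]
    rw [hQx₃, hQs, hQX₁, hQz, ← hww]; ring
  have hσu : ∀ i : Fin 2, sigmaR τP (![z, X₀] : Fin 2 → Localization.Away hh₁) ![1, 1] hσJ₂ hp.pos hσp₂ (cobordantAlgebra.u' (![z, X₀] : Fin 2 → Localization.Away hh₁) ![1, 1] i) = cobordantAlgebra.u' (![z, X₀] : Fin 2 → Localization.Away hh₁) ![1, 1] i := by
    intro i
    refine Subtype.ext ?_
    rw [coe_sigmaR, cobordantAlgebra.coe_u', sigmaT_C_mul_T]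
    fin_cases i
    · change LaurentPolynomial.C (τP z) * _ = LaurentPolynomial.C z * _; rw [rz]
    · change LaurentPolynomial.C (τP X₀) * _ = LaurentPolynomial.C X₀ * _; rw [r1]
  have hσZ : conj ΦQ (sigmaChart 𝒜P (![z, X₀] : Fin 2 → Localization.Away hh₁) ![1, 1] (d₂ * (d * (2 * p))) y₀ hy₀ τP hσJ₂ hp.pos hσp₂ hσy₀) (algebraMap (MvPolynomial (Option (Option (Fin 4))) k) (Localization.Away hQ) (X (some (some 2)))) = algebraMap (MvPolynomial (Option (Option (Fin 4))) k) (Localization.Away hQ) (X (some (some 2))) := by rw [← hQu0, hτ]; rw [sigmaChart_algebraMap, hσu 0]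
  have hσY : conj ΦQ (sigmaChart 𝒜P (![z, X₀] : Fin 2 → Localization.Away hh₁) ![1, 1] (d₂ * (d * (2 * p))) y₀ hy₀ τP hσJ₂ hp.pos hσp₂ hσy₀) (algebraMap (MvPolynomial (Option (Option (Fin 4))) k) (Localization.Away hQ) (X (some (some 0)))) = algebraMap (MvPolynomial (Option (Option (Fin 4))) k) (Localization.Away hQ) (X (some (some 0))) := by rw [← hQu1, hτ]; rw [sigmaChart_algebraMap, hσu 1]
  have hσw : conj ΦQ (sigmaChart 𝒜P (![z, X₀] : Fin 2 → Localization.Away hh₁) ![1, 1] (d₂ * (d * (2 * p))) y₀ hy₀ τP hσJ₂ hp.pos hσp₂ hσy₀) (algebraMap (MvPolynomial (Option (Option (Fin 4))) k) (Localization.Away hQ) (X none)) = algebraMap (MvPolynomial (Option (Option (Fin 4))) k) (Localization.Away hQ) (X none) + algebraMap (MvPolynomial (Option (Option (Fin 4))) k) (Localization.Away hQ) (X (some none)) ^ 2 * t * algebraMap (MvPolynomial (Option (Option (Fin 4))) k) (Localization.Away hQ) (X (some (some 0))) := by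
    rw [← hww, map_add, map_mul, map_mul, hσZ, hσt, hσs, hσX₁]; ring
  have hση : conj ΦQ (sigmaChart 𝒜P (![z, X₀] : Fin 2 → Localization.Away hh₁) ![1, 1] (d₂ * (d * (2 * p))) y₀ hy₀ τP hσJ₂ hp.pos hσp₂ hσy₀) η' = η' := hσfixP _ (r5 _ (Set.mem_union_left _ (Set.mem_singleton _)))
  have hσηh : conj ΦQ (sigmaChart 𝒜P (![z, X₀] : Fin 2 → Localization.Away hh₁) ![1, 1] (d₂ * (d * (2 * p))) y₀ hy₀ τP hσJ₂ hp.pos hσp₂ hσy₀) ηh = ηh := hσfixP _ rh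
  have hσc₀ : conj ΦQ (sigmaChart 𝒜P (![z, X₀] : Fin 2 → Localization.Away hh₁) ![1, 1] (d₂ * (d * (2 * p))) y₀ hy₀ τP hσJ₂ hp.pos hσp₂ hσy₀) c₀' = c₀' := by rw [hc₀'def, hτ]; rw [sigmaChart_algebraMap, sigmaR_coverElement]; exact hσy₀
  have hσκ : conj ΦQ (sigmaChart 𝒜P (![z, X₀] : Fin 2 → Localization.Away hh₁) ![1, 1] (d₂ * (d * (2 * p))) y₀ hy₀ τP hσJ₂ hp.pos hσp₂ hσy₀) κ' = κ' := by rw [hκ'def, hτ]; rw [sigmaChart_invSelf]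
  have hσC : ∀ c : k, conj ΦQ (sigmaChart 𝒜P (![z, X₀] : Fin 2 → Localization.Away hh₁) ![1, 1] (d₂ * (d * (2 * p))) y₀ hy₀ τP hσJ₂ hp.pos hσp₂ hσy₀) (algebraMap (MvPolynomial (Option (Option (Fin 4))) k) (Localization.Away hQ) (C c)) = algebraMap (MvPolynomial (Option (Option (Fin 4))) k) (Localization.Away hQ) (C c) := by
    intro c; rw [← hQC]
    refine hσfixP _ ?_
    rw [← MvPolynomial.algebraMap_eq, ← IsScalarTower.algebraMap_apply k (MvPolynomial (Option (Fin 4)) k) (Localization.Away hh₁) c]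
    exact r5 _ (Set.mem_union_right _ ⟨c, rfl⟩)
  have hσhQ : conj ΦQ (sigmaChart 𝒜P (![z, X₀] : Fin 2 → Localization.Away hh₁) ![1, 1] (d₂ * (d * (2 * p))) y₀ hy₀ τP hσJ₂ hp.pos hσp₂ hσy₀) (algebraMap (MvPolynomial (Option (Option (Fin 4))) k) (Localization.Away hQ) hQ) = algebraMap (MvPolynomial (Option (Option (Fin 4))) k) (Localization.Away hQ) hQ := by rw [hQh]; simp only [map_mul, map_pow, hσZ, hσηh]
  have hσhQinv : conj ΦQ (sigmaChart 𝒜P (![z, X₀] : Fin 2 → Localization.Away hh₁) ![1, 1] (d₂ * (d * (2 * p))) y₀ hy₀ τP hσJ₂ hp.pos hσp₂ hσy₀) (IsLocalization.Away.invSelf hQ) = IsLocalization.Away.invSelf hQ := apply_eq_of_mul_eq_one _ (IsLocalization.Away.mul_invSelf _) hσhQ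
  have hfix : ∀ g' ∈ ((({IsLocalization.Away.invSelf hQ} : Set (Localization.Away hQ)) ∪ Set.range (algebraMap k (Localization.Away hQ)))), conj ΦQ (sigmaChart 𝒜P (![z, X₀] : Fin 2 → Localization.Away hh₁) ![1, 1] (d₂ * (d * (2 * p))) y₀ hy₀ τP hσJ₂ hp.pos hσp₂ hσy₀) g' = g' := by
    rintro g' (hg | ⟨c, rfl⟩)
    · rw [Set.mem_singleton_iff.mp hg]; exact hσhQinv
    · rw [IsScalarTower.algebraMap_apply k (MvPolynomial (Option (Option (Fin 4))) k) (Localization.Away hQ) c, MvPolynomial.algebraMap_eq, hσC]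
  -- characteristic, units, K1′
  have hu₃ : MvPolynomial.eval (fun o : Option (Option (Fin 4)) => if o = some (some 1) ∨ o = some (some 2) then (1 : k) else 0) hQ ≠ 0 := by rw [hhQ]; simp
  haveI hcharQ := charP_away_of_eval_ne_zero p _ _ hu₃
  have hNfix : conj ΦQ (sigmaChart 𝒜P (![z, X₀] : Fin 2 → Localization.Away hh₁) ![1, 1] (d₂ * (d * (2 * p))) y₀ hy₀ τP hσJ₂ hp.pos hσp₂ hσy₀) (∏ j : ZMod p, (algebraMap (MvPolynomial (Option (Option (Fin 4))) k) (Localization.Away hQ) (X (some (some 1))) + (j.val : Localization.Away hQ) * (algebraMap (MvPolynomial (Option (Option (Fin 4))) k) (Localization.Away hQ) (X (some none)) * t * algebraMap (MvPolynomial (Option (Option (Fin 4))) k) (Localization.Away hQ) (X (some (some 0)))))) = ∏ j : ZMod p, (algebraMap (MvPolynomial (Option (Option (Fin 4))) k) (Localization.Away hQ) (X (some (some 1))) + (j.val : Localization.Away hQ) * (algebraMap (MvPolynomial (Option (Option (Fin 4))) k) (Localization.Away hQ) (X (some none)) * t * algebraMap (MvPolynomial (Option (Option (Fin 4))) k) (Localization.Away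 hQ) (X (some (some 0))))) :=
    A1.prod_shift_fixed hp1 _ _ _ hσX₁ (by rw [map_mul, map_mul, hσs, hσt, hσY])
  have hX₁u : IsUnit (algebraMap (MvPolynomial (Option (Option (Fin 4))) k) (Localization.Away hQ) (X (some (some 1)))) := by
    refine isUnit_of_dvd_unit (map_dvd _ ?_) (IsLocalization.Away.algebraMap_isUnit hQ)
    rw [hhQ]
    refine Dvd.dvd.mul_right (Dvd.dvd.trans ?_ (dvd_pow_self _ (Nat.mul_ne_zero two_ne_zero hd.ne'))) _
    have h0 := Finset.dvd_prod_of_mem (fun j : ZMod p => (X (some (some 2)) * X (some (some 1)) + C (j.val : k) * ((X none - X (some none) * X (some (some 1))) * X (some (some 0)) * X (some none)) : MvPolynomial (Option (Option (Fin 4))) k)) (Finset.mem_univ (0 : ZMod p))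
    simp only [ZMod.val_zero, Nat.cast_zero, C_0, zero_mul, add_zero] at h0
    exact Dvd.dvd.trans (Dvd.intro_left _ rfl) h0
  have hZu : IsUnit (algebraMap (MvPolynomial (Option (Option (Fin 4))) k) (Localization.Away hQ) (X (some (some 2)))) := isUnit_of_dvd_unit (map_dvd _ huh') (IsLocalization.Away.algebraMap_isUnit hQ)
  have hκu : IsUnit κ' := IsUnit.of_mul_eq_one c₀' ((mul_comm _ _).trans hcκ)
  have hη'u : IsUnit η' := IsUnit.of_mul_eq_one ηh ((mul_comm _ _).trans hηη)
  have hfacQ : ∀ j : ZMod p, algebraMap (MvPolynomial (Option (Option (Fin 4))) k) (Localization.Away hQ) (X (some (some 2)) * X (some (some 1)) + C (j.val : k) * ((X none - X (some none) * X (some (some 1))) * X (some (some 0)) * X (some none))) =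
      algebraMap (MvPolynomial (Option (Option (Fin 4))) k) (Localization.Away hQ) (X (some (some 2))) * (algebraMap (MvPolynomial (Option (Option (Fin 4))) k) (Localization.Away hQ) (X (some (some 1))) + (j.val : Localization.Away hQ) * (algebraMap (MvPolynomial (Option (Option (Fin 4))) k) (Localization.Away hQ) (X (some none)) * t * algebraMap (MvPolynomial (Option (Option (Fin 4))) k) (Localization.Away hQ) (X (some (some 0))))) := by
    intro j
    simp only [map_add, map_mul, map_sub, map_natCast]
    linear_combination (-((j.val : Localization.Away hQ) * algebraMap (MvPolynomial (Option (Option (Fin 4))) k) (Localization.Away hQ) (X (some (some 0))) * algebraMap (MvPolynomial (Option (Option (Fin 4))) k) (Localization.Away hQ) (X (some none)))) * hww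
  have hNu : IsUnit (∏ j : ZMod p, (algebraMap (MvPolynomial (Option (Option (Fin 4))) k) (Localization.Away hQ) (X (some (some 1))) + (j.val : Localization.Away hQ) * (algebraMap (MvPolynomial (Option (Option (Fin 4))) k) (Localization.Away hQ) (X (some none)) * t * algebraMap (MvPolynomial (Option (Option (Fin 4))) k) (Localization.Away hQ) (X (some (some 0)))))) := by
    have h : IsUnit (algebraMap (MvPolynomial (Option (Option (Fin 4))) k) (Localization.Away hQ) ((∏ j : ZMod p, (X (some (some 2)) * X (some (some 1)) + C (j.val : k) * ((X none - X (some none) * X (some (some 1))) * X (some (some 0)) * X (some none)))) ^ (2 * d) * X (some (some 2)) ^ (d₂ * (d * (2 * p))))) := by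
      rw [← hhQ]; exact IsLocalization.Away.algebraMap_isUnit hQ
    rw [map_mul, map_pow, map_prod, Finset.prod_congr rfl (fun j _ => hfacQ j), Finset.prod_mul_distrib, Finset.prod_const, Finset.card_univ, ZMod.card] at h
    exact isUnit_of_mul_isUnit_right ((isUnit_pow_iff (Nat.mul_ne_zero two_ne_zero hd.ne')).mp (isUnit_of_mul_isUnit_left h))
  have hg₃ : ∀ i, (fun o : Option (Option (Fin 4)) => if o = some (some 1) ∨ o = some (some 2) then (1 : k) else 0) ((![some (some 0), none] : Fin 2 → Option (Option (Fin 4))) i) = 0 := by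
    intro i; fin_cases i <;> exact if_neg (by decide)
  have hv₃ : Function.Injective (![some (some 0), none] : Fin 2 → Option (Option (Fin 4))) := by
    intro i j hij; fin_cases i <;> fin_cases j <;> first | rfl | exact absurd hij (by decide)
  have hfv₃ : (fun i => algebraMap (MvPolynomial (Option (Option (Fin 4))) k) (Localization.Away hQ) (X ((![some (some 0), none] : Fin 2 → Option (Option (Fin 4))) i))) = ![algebraMap (MvPolynomial (Option (Option (Fin 4))) k) (Localization.Away hQ) (X (some (some 0))), algebraMap (MvPolynomial (Option (Option (Fin 4))) k) (Localization.Away hQ) (X none)] := by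
    funext i; fin_cases i <;> rfl
  have hK1 := isRegular_algebraMap_X_away k hQ _ hv₃ _ hg₃ hu₃
  have hK1' := isRegularRing_quotient_X_away k hQ (![some (some 0), none] : Fin 2 → Option (Option (Fin 4)))
  rw [hfv₃] at hK1 hK1'
  -- generation
  have hgen := closure_range_X_invSelf_eq_top k hQ
  have hgen' : Subring.closure (({t, algebraMap (MvPolynomial (Option (Option (Fin 4))) k) (Localization.Away hQ) (X (some none)), algebraMap (MvPolynomial (Option (Option (Fin 4))) k) (Localization.Away hQ) (X (some (some 0))), algebraMap (MvPolynomial (Option (Option (Fin 4))) k) (Localization.Away hQ) (X (some (some 1))), algebraMap (MvPolynomial (Option (Option (Fin 4))) k) (Localization.Away hQ) (X (some (some 2))), algebraMap (MvPolynomial (Option (Option (Fin 4))) k) (Localization.Away hQ) (X (some (some 3))), algebraMap (MvPolynomial (Option (Option (Fin 4))) k) (Localization.Away hQ) (X none)} : Set (Localization.Away hQ)) ∪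
      ((({IsLocalization.Away.invSelf hQ} : Set (Localization.Away hQ)) ∪ Set.range (algebraMap k (Localization.Away hQ))))) = ⊤ := by
    refine top_le_iff.mp (hgen.ge.trans (Subring.closure_mono ?_))
    rintro x (⟨o, rfl⟩ | hx)
    · refine Set.mem_union_left _ ?_
      rcases o with _ | _ | o
      · simp
      · simp
      · fin_cases o <;> simp
    · exact Set.mem_union_right _ hx
  -- ### degrees
  have hdQ : ∀ {x : Localization.Away hh₁} {δ : Π j : Fin m, ZMod (r j)}, x ∈ 𝒜P δ → ΦQ (algebraMap ↥(cobordantAlgebra (![z, X₀] : Fin 2 → Localization.Away hh₁) ![1, 1]) (ChartRing 𝒜P (![z, X₀] : Fin 2 → Localization.Away hh₁) ![1, 1] (d₂ * (d * (2 * p))) y₀ hy₀) (algebraMap (Localization.Away hh₁) ↥(cobordantAlgebra (![z, X₀] : Fin 2 → Localization.Away hh₁) ![1, 1]) x)) ∈ mapGrading (chartNodeGrading r 𝒜P (![z, X₀] : Fin 2 → Localization.Away hh₁) ![1, 1] hf₂ (d₂ * (d * (2 * p))) y₀ hy₀) ΦQ (consIndexEquiv r ((0 : ℤ), δ)) :=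
    fun hx => map_algebraMap_mem_mapGrading r 𝒜P _ ![1, 1] hf₂ _ y₀ hy₀ ΦQ (algebraMap_mem_reesPiece 𝒜P _ _ hx)
  have dY : algebraMap (MvPolynomial (Option (Option (Fin 4))) k) (Localization.Away hQ) (X (some (some 0))) ∈ mapGrading (chartNodeGrading r 𝒜P (![z, X₀] : Fin 2 → Localization.Away hh₁) ![1, 1] hf₂ (d₂ * (d * (2 * p))) y₀ hy₀) ΦQ (consIndexEquiv r ((1 : ℤ), 2 • θ)) := by
    rw [← hQu1]; exact map_algebraMap_mem_mapGrading r 𝒜P _ ![1, 1] hf₂ _ y₀ hy₀ ΦQ (u'_mem_reesPiece 𝒜P _ _ hf₂ 1)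
  have dZ : algebraMap (MvPolynomial (Option (Option (Fin 4))) k) (Localization.Away hQ) (X (some (some 2))) ∈ mapGrading (chartNodeGrading r 𝒜P (![z, X₀] : Fin 2 → Localization.Away hh₁) ![1, 1] hf₂ (d₂ * (d * (2 * p))) y₀ hy₀) ΦQ (consIndexEquiv r ((1 : ℤ), 0)) := by
    rw [← hQu0]; exact map_algebraMap_mem_mapGrading r 𝒜P _ ![1, 1] hf₂ _ y₀ hy₀ ΦQ (u'_mem_reesPiece 𝒜P _ _ hf₂ 0)
  have dt : t ∈ mapGrading (chartNodeGrading r 𝒜P (![z, X₀] : Fin 2 → Localization.Away hh₁) ![1, 1] hf₂ (d₂ * (d * (2 * p))) y₀ hy₀) ΦQ (consIndexEquiv r ((-1 : ℤ), 0)) := by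
    rw [← hQS]; exact map_algebraMap_mem_mapGrading r 𝒜P _ ![1, 1] hf₂ _ y₀ hy₀ ΦQ (s_mem_reesPiece 𝒜P _ _)
  have ds : algebraMap (MvPolynomial (Option (Option (Fin 4))) k) (Localization.Away hQ) (X (some none)) ∈ mapGrading (chartNodeGrading r 𝒜P (![z, X₀] : Fin 2 → Localization.Away hh₁) ![1, 1] hf₂ (d₂ * (d * (2 * p))) y₀ hy₀) ΦQ (consIndexEquiv r ((0 : ℤ), -θ)) := by rw [← hQs]; exact hdQ dgs
  have dX₁ : algebraMap (MvPolynomial (Option (Option (Fin 4))) k) (Localization.Away hQ) (X (some (some 1))) ∈ mapGrading (chartNodeGrading r 𝒜P (![z, X₀] : Fin 2 → Localization.Away hh₁) ![1, 1] hf₂ (d₂ * (d * (2 * p))) y₀ hy₀) ΦQ (consIndexEquiv r ((0 : ℤ), θ)) := by rw [← hQX₁]; exact hdQ dg1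
  have dη : η' ∈ mapGrading (chartNodeGrading r 𝒜P (![z, X₀] : Fin 2 → Localization.Away hh₁) ![1, 1] hf₂ (d₂ * (d * (2 * p))) y₀ hy₀) ΦQ (consIndexEquiv r ((0 : ℤ), -((d * (2 * p)) • θ))) := hdQ dgη
  have dκ : κ' ∈ mapGrading (chartNodeGrading r 𝒜P (![z, X₀] : Fin 2 → Localization.Away hh₁) ![1, 1] hf₂ (d₂ * (d * (2 * p))) y₀ hy₀) ΦQ (consIndexEquiv r (-((d₂ * (d * (2 * p)) : ℕ) : ℤ), 0)) := map_invSelf_mem_mapGrading r 𝒜P _ ![1, 1] hf₂ _ y₀ hy₀ ΦQ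
  have hcIE0 : consIndexEquiv r ((0 : ℤ), (0 : Π j : Fin m, ZMod (r j))) = 0 := by rw [Prod.mk_zero_zero, map_zero]
  have dw : algebraMap (MvPolynomial (Option (Option (Fin 4))) k) (Localization.Away hQ) (X none) ∈ mapGrading (chartNodeGrading r 𝒜P (![z, X₀] : Fin 2 → Localization.Away hh₁) ![1, 1] hf₂ (d₂ * (d * (2 * p))) y₀ hy₀) ΦQ 0 := by
    rw [← hww]
    refine add_mem ?_ ?_
    · have h := SetLike.mul_mem_graded dZ dt
      rwa [← map_add, Prod.mk_add_mk, show (1 : ℤ) + -1 = 0 by norm_num, add_zero, hcIE0] at h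
    · have h := SetLike.mul_mem_graded ds dX₁
      rwa [← map_add, Prod.mk_add_mk, add_zero, neg_add_cancel, hcIE0] at h
  have dδ : algebraMap (MvPolynomial (Option (Option (Fin 4))) k) (Localization.Away hQ) (X (some none)) ^ 2 * t * algebraMap (MvPolynomial (Option (Option (Fin 4))) k) (Localization.Away hQ) (X (some (some 0))) ∈ mapGrading (chartNodeGrading r 𝒜P (![z, X₀] : Fin 2 → Localization.Away hh₁) ![1, 1] hf₂ (d₂ * (d * (2 * p))) y₀ hy₀) ΦQ 0 := by
    have h := SetLike.mul_mem_graded (SetLike.mul_mem_graded (SetLike.pow_mem_graded 2 ds) dt) dY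
    have e : 2 • consIndexEquiv r ((0 : ℤ), -θ) + consIndexEquiv r ((-1 : ℤ), (0 : Π j : Fin m, ZMod (r j))) + consIndexEquiv r ((1 : ℤ), 2 • θ) = 0 := by
      rw [← map_nsmul, ← map_add, ← map_add, ← hcIE0]
      congr 1
      refine Prod.ext ?_ ?_
      · simp only [Prod.fst_add, Prod.smul_fst]; norm_num
      · simp only [Prod.snd_add, Prod.smul_snd, smul_neg, add_zero, neg_add_cancel]
    rwa [e] at h
  have dV : algebraMap (MvPolynomial (Option (Option (Fin 4))) k) (Localization.Away hQ) (X (some (some 0))) ^ (2 * d * d₂ * p) * (κ' * η' ^ (2 * d₂)) ∈ mapGrading (chartNodeGrading r 𝒜P (![z, X₀] : Fin 2 → Localization.Away hh₁) ![1, 1] hf₂ (d₂ * (d * (2 * p))) y₀ hy₀) ΦQ 0 := by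
    have h := SetLike.mul_mem_graded (SetLike.pow_mem_graded (2 * d * d₂ * p) dY) (SetLike.mul_mem_graded dκ (SetLike.pow_mem_graded (2 * d₂) dη))
    have e : (2 * d * d₂ * p) • consIndexEquiv r ((1 : ℤ), 2 • θ) + (consIndexEquiv r (-((d₂ * (d * (2 * p)) : ℕ) : ℤ), (0 : Π j : Fin m, ZMod (r j))) + (2 * d₂) • consIndexEquiv r ((0 : ℤ), -((d * (2 * p)) • θ))) = 0 := by
      rw [← map_nsmul, ← map_nsmul, ← map_add, ← map_add, ← hcIE0]
      congr 1
      refine Prod.ext ?_ ?_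
      · simp only [Prod.fst_add, Prod.smul_fst, smul_zero, add_zero]; push_cast; ring
      · simp only [Prod.snd_add, Prod.smul_snd, smul_neg, zero_add]
        rw [← mul_nsmul, ← mul_nsmul, show 2 * (2 * d * d₂ * p) = d * (2 * p) * (2 * d₂) by ring, add_neg_cancel]
    rwa [e] at h
  have dN : algebraMap (MvPolynomial (Option (Option (Fin 4))) k) (Localization.Away hQ) (X (some none)) ^ p * (∏ j : ZMod p, (algebraMap (MvPolynomial (Option (Option (Fin 4))) k) (Localization.Away hQ) (X (some (some 1))) + (j.val : Localization.Away hQ) * (algebraMap (MvPolynomial (Option (Option (Fin 4))) k) (Localization.Away hQ) (X (some none)) * t * algebraMap (MvPolynomial (Option (Option (Fin 4))) k) (Localization.Away hQ) (X (some (some 0)))))) ∈ mapGrading (chartNodeGrading r 𝒜P (![z, X₀] : Fin 2 → Localization.Away hh₁) ![1, 1] hf₂ (d₂ * (d * (2 * p))) y₀ hy₀) ΦQ 0 := by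
    have hstY : algebraMap (MvPolynomial (Option (Option (Fin 4))) k) (Localization.Away hQ) (X (some none)) * t * algebraMap (MvPolynomial (Option (Option (Fin 4))) k) (Localization.Away hQ) (X (some (some 0))) ∈ mapGrading (chartNodeGrading r 𝒜P (![z, X₀] : Fin 2 → Localization.Away hh₁) ![1, 1] hf₂ (d₂ * (d * (2 * p))) y₀ hy₀) ΦQ (consIndexEquiv r ((0 : ℤ), θ)) := by
      have h := SetLike.mul_mem_graded (SetLike.mul_mem_graded ds dt) dY
      have e : consIndexEquiv r ((0 : ℤ), -θ) + consIndexEquiv r ((-1 : ℤ), (0 : Π j : Fin m, ZMod (r j))) + consIndexEquiv r ((1 : ℤ), 2 • θ) = consIndexEquiv r ((0 : ℤ), θ) := by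
        rw [← map_add, ← map_add]
        congr 1
        refine Prod.ext ?_ ?_
        · simp only [Prod.fst_add]; norm_num
        · simp only [Prod.snd_add, add_zero, two_nsmul, neg_add_cancel_left]
      rwa [e] at h
    have hfac : ∀ j : ZMod p, algebraMap (MvPolynomial (Option (Option (Fin 4))) k) (Localization.Away hQ) (X (some (some 1))) + (j.val : Localization.Away hQ) * (algebraMap (MvPolynomial (Option (Option (Fin 4))) k) (Localization.Away hQ) (X (some none)) * t * algebraMap (MvPolynomial (Option (Option (Fin 4))) k) (Localization.Away hQ) (X (some (some 0)))) ∈ mapGrading (chartNodeGrading r 𝒜P (![z, X₀] : Fin 2 → Localization.Away hh₁) ![1, 1] hf₂ (d₂ * (d * (2 * p))) y₀ hy₀) ΦQ (consIndexEquiv r ((0 : ℤ), θ)) := by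
      intro j
      refine add_mem dX₁ ?_
      have hn : ((j.val : Localization.Away hQ)) ∈ mapGrading (chartNodeGrading r 𝒜P (![z, X₀] : Fin 2 → Localization.Away hh₁) ![1, 1] hf₂ (d₂ * (d * (2 * p))) y₀ hy₀) ΦQ 0 := SetLike.natCast_mem_graded _ _
      have := SetLike.mul_mem_graded hn hstY
      rwa [zero_add] at this
    have hN := SetLike.prod_mem_graded (A := mapGrading (chartNodeGrading r 𝒜P (![z, X₀] : Fin 2 → Localization.Away hh₁) ![1, 1] hf₂ (d₂ * (d * (2 * p))) y₀ hy₀) ΦQ) (i := fun _ => consIndexEquiv r ((0 : ℤ), θ)) (g := fun j : ZMod p => algebraMap (MvPolynomial (Option (Option (Fin 4))) k) (Localization.Away hQ) (X (some (some 1))) + (j.val : Localization.Away hQ) * (algebraMap (MvPolynomial (Option (Option (Fin 4))) k) (Localization.Away hQ) (X (some none)) * t * algebraMap (MvPolynomial (Option (Option (Fin 4))) k) (Localization.Away hQ) (X (some (some 0))))) (F := Finset.univ) (fun j _ => hfac j)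
    rw [Finset.sum_const, Finset.card_univ, ZMod.card] at hN
    have h := SetLike.mul_mem_graded (SetLike.pow_mem_graded p ds) hN
    rwa [← map_nsmul, ← map_nsmul, ← map_add, ← smul_add, Prod.mk_add_mk, add_zero, neg_add_cancel, Prod.mk_zero_zero, smul_zero, map_zero] at h
  refine ⟨ΦQ, t, κ' * η' ^ (2 * d₂), c₀' * ηh ^ (2 * d₂), ∏ j : ZMod p, (algebraMap (MvPolynomial (Option (Option (Fin 4))) k) (Localization.Away hQ) (X (some (some 1))) + (j.val : Localization.Away hQ) * (algebraMap (MvPolynomial (Option (Option (Fin 4))) k) (Localization.Away hQ) (X (some none)) * t * algebraMap (MvPolynomial (Option (Option (Fin 4))) k) (Localization.Away hQ) (X (some (some 0))))),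
    hσt, hσs, hσY, hσZ, hσX₁, hσx₃, hσw, by rw [map_mul, map_pow, hσκ, hση], by rw [mul_mul_mul_comm, hcκ, one_mul, ← mul_pow, hηη, one_pow], hNfix, hfix, hσhQ, hgen', hX₁u, hZu,
    hκu.mul (hη'u.pow _), hNu, dY, dw, dδ, dV, ds, dt, dN, hK1, hK1', hcharQ, hQu1, hQX₀⟩

end Summit.ResolutionOfSingularities.ResolutionOfSingularities.Theorems.WildQuotientResolution.S1.KillCert.D4

end
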